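import Mathlib
import HarnessLib
import Summits.Parity.GeneralizedHardyLittlewood.Theorems.DilatedChowla.Negative.DilatedChowlaMirrorDefs

/-!
# `DilatedChowla` (stmt-Parity-13319): reading the mirror's conclusion

The mirror line (card `siegel-mirror`) concludes `DilatedChowla → ∃ C₀ > 0, ¬ SiegelZerosAbove (C₀ · log)`.
This file records what that conclusion SAYS and where it sits:

* `realZeroFree_of_not_siegelZerosAbove` — `¬ SiegelZerosAbove (C₀ · log)` is a real-zero-free
  interval: for all conductors `q ≥ q₀` and all primitive quadratic `χ mod q`, `L(σ, χ) ≠ 0` for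
  `σ ∈ [1 − 1/(C₀ log² q), 1)` (unconditionally known only with Siegel's ineffective `q^{−ε}` in
  place of `1/(C₀ log² q)`);
* `not_siegelZerosAbove_log_of_noSiegelZeros` — it is implied by the tree's open no-Siegel-zero
  statement rh.S34 (`Literature.NumberTheory.LFunctions.NoSiegelZeros`), hence expected TRUE: the
  mirror certifies the crux Landau–Siegel-hard; it does not refute it.
-/

noncomputable section

namespace Summit.Parity.GeneralizedHardyLittlewood.Theorems.DilatedChowla.Negative

open Literature.Barriers.Parity (IsSiegelZero)

/-- **Zero-free reading.** If Siegel zeros of quality `≥ C₀ log q` do not occur at arbitrarily large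
conductors (`¬ SiegelZerosAbove (C₀ · log)`, `C₀ > 0`), then there is `q₀` such that for every
conductor `q ≥ q₀` and every primitive quadratic `χ mod q`, `L(σ, χ) ≠ 0` for all real
`σ ∈ [1 − 1/(C₀ log² q), 1)`. -/
theorem realZeroFree_of_not_siegelZerosAbove {C₀ : ℝ} (hC₀ : 0 < C₀)
    (h : ¬ SiegelZerosAbove (fun q => C₀ * Real.log q)) :
    ∃ q₀ : ℕ, ∀ (q : ℕ) [NeZero q] (χ : DirichletCharacter ℂ q), χ.IsPrimitive → χ.IsQuadratic →
      q₀ ≤ q → ∀ σ : ℝ, 1 - 1 / (C₀ * Real.log q ^ 2) ≤ σ → σ < 1 → χ.LFunction (σ : ℂ) ≠ 0 := by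
  classical
  unfold SiegelZerosAbove at h
  push Not at h
  obtain ⟨q₁, hq₁⟩ := h
  -- threshold: `q ≥ q₁` and `C₀ log q ≥ 10`
  obtain ⟨q₂, hq₂⟩ : ∃ q₂ : ℕ, ∀ q : ℕ, q₂ ≤ q → 10 ≤ C₀ * Real.log q := by
    refine ⟨⌈Real.exp (10 / C₀)⌉₊ + 1, fun q hq => ?_⟩
    have hq' : Real.exp (10 / C₀) ≤ q := by
      have h1 : Real.exp (10 / C₀) ≤ ⌈Real.exp (10 / C₀)⌉₊ := Nat.le_ceil _
      have h2 : (⌈Real.exp (10 / C₀)⌉₊ : ℝ) + 1 ≤ q := by exact_mod_cast hq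
      linarith
    have hlog : 10 / C₀ ≤ Real.log q := by
      rw [← Real.log_exp (10 / C₀)]
      exact Real.log_le_log (Real.exp_pos _) hq'
    rw [div_le_iff₀ hC₀] at hlog
    linarith
  refine ⟨max q₁ q₂, fun q _ χ hprim hquad hq σ hσ hσ1 hL => ?_⟩
  have hq1 : q₁ ≤ q := le_trans (le_max_left _ _) hq
  have hten : 10 ≤ C₀ * Real.log q := hq₂ q (le_trans (le_max_right _ _) hq)
  have hlogpos : 0 < Real.log q := by
    by_contra hcon
    push Not at hcon
    have : C₀ * Real.log q ≤ 0 := mul_nonpos_of_nonneg_of_nonpos hC₀.le hcon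
    linarith
  have h1σ : 0 < 1 - σ := by linarith
  -- the quality of the zero `σ`
  set η : ℝ := 1 / ((1 - σ) * Real.log q) with hη
  have hηpos : 0 < η := by rw [hη]; positivity
  have hσeq : 1 - 1 / (η * Real.log q) = σ := by
    rw [hη]; field_simp; ring
  have hquality : C₀ * Real.log q ≤ η := by
    -- `1 - σ ≤ 1/(C₀ log² q)` ⇒ `(1 - σ) log q · (C₀ log q) ≤ 1`
    have hb : 1 - σ ≤ 1 / (C₀ * Real.log q ^ 2) := by linarith
    rw [hη, le_div_iff₀ (by positivity)]
    have hpos : 0 < C₀ * Real.log q ^ 2 := by positivity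
    rw [le_div_iff₀ hpos] at hb
    nlinarith
  have hz : IsSiegelZero χ η := by
    refine ⟨hprim, hquad, le_trans hten hquality, ?_⟩
    rw [hσeq]; exact hL
  exact hq₁ q ‹NeZero q› χ η hq1 hquality hz

/-- **Consistency check.** The mirror's conclusion is (much) weaker than the tree's open
no-Siegel-zero statement rh.S34: `NoSiegelZeros → ¬ SiegelZerosAbove (C₀ · log)` for every `C₀ > 0`
(indeed `SiegelZerosAbove (C₀ · log)` gives zeros of unbounded quality, refuted by rh.S34 through
`not_unboundedSiegelZeros_of_noSiegelZeros`). So the mirror is expected to hold, and is a genuine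
consequence of the crux, not a refutation of it. -/
theorem not_siegelZerosAbove_log_of_noSiegelZeros {C₀ : ℝ} (hC₀ : 0 < C₀)
    (h : Literature.NumberTheory.LFunctions.NoSiegelZeros) :
    ¬ SiegelZerosAbove (fun q => C₀ * Real.log q) := by
  intro hz
  refine Literature.Barriers.Parity.not_unboundedSiegelZeros_of_noSiegelZeros h
    (siegelZerosAbove_imp_unbounded ?_ hz)
  intro η₀
  refine ⟨⌈Real.exp (η₀ / C₀)⌉₊ + 1, fun q hq => ?_⟩
  have hq' : Real.exp (η₀ / C₀) ≤ q := by
    have h1 : Real.exp (η₀ / C₀) ≤ ⌈Real.exp (η₀ / C₀)⌉₊ := Nat.le_ceil _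
    have h2 : (⌈Real.exp (η₀ / C₀)⌉₊ : ℝ) + 1 ≤ q := by exact_mod_cast hq
    linarith
  have hlog : η₀ / C₀ ≤ Real.log q := by
    rw [← Real.log_exp (η₀ / C₀)]
    exact Real.log_le_log (Real.exp_pos _) hq'
  rw [div_le_iff₀ hC₀] at hlog
  linarith

end Summit.Parity.GeneralizedHardyLittlewood.Theorems.DilatedChowla.Negative

end
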